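import Summits.QuantumFields.YangMills.Theorems.SwapVirialDeficitSectorLaplaceTipHubHubCot
import Summits.QuantumFields.YangMills.Theorems.SwapVirialDeficitSectorLaplaceEndCoreAssembly
import HarnessLib

/-!
# Route `SwapVirialDeficit` (YangMills): `stub_core_tip` OF SKELETON ➎ REDUCED TO ONE MATCHED COMPARISON IN THE LETTERS `(δ, η)`
# (cell ym-idea-1, brick (T5)(b) of w2 g60's tip memo `w2-g60-memo-24197-tip-assembly.md`; the twin of LEAD g99's ✓`stub_core_end_of_gaussHalf`;
# free-hands support of ⟨stmt-QuantumFields-24197⟩ `SwapVirialDeficit.SwapGluedStiffness`)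

★★★ `stub_core_tip_of_tipBound` — if for every `L`, every cut `0 < τ ≤ τ₀∕L^k`, every `b ≥ K·L^k·τ⁻¹^k` and every good sign pattern `ε`
`κ_L·coneConst·π·∫_{{(1+δ²)⁻¹ < τ}} e^{−bF̂(hubAt δ 1, ε, η)} dμ_B ≤ (1∕64)·(2π∕b)^α·∫_{HubBulk τ}∫_{ℝ²}𝔪_ε` (THE TIP BOUND `hT`: the tip slab against the bulk's Morse–Bott
main term, in the letters of ✓`setIntegral_tipHub_exp_eq_hubCot`), then `stub_core_tip` of ➎ v8 = v9 = v10 holds VERBATIM: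
`κ_L·Σ_ε ∫_{TipHub τ ×ˢ univ} e^{−bF̂} d(chartMeasure) ≤ (1∕32)·Σ_ε ∫_{HubBulk τ} hubIntegral dcone` above a merged polynomial threshold — by
✓`setIntegral_tipHub_exp_eq_hubCot` (reading) and LEAD's ✓`bulkHub_ge_half_main` (`½(2π∕b)^α M_ε ≤ ∫_{HubBulk τ} hubIntegral`; budget `1∕64 ≤ ½·1∕32`).
So the tip stub is EXACTLY the analytic statement `hT`, whose proof is the chain (B1)–(D) of the memo (✓follower_laplace_ceiling, ✓K7g matching,
✓det_gnoFolHessian_apex_rot, ✓exists_parallel_near, ✓mbDensity_ge_detFol, leader-side apex integrals, smearing).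

HONEST LABEL: bookkeeping (threshold merging); `hT` is NOT proved here; `stub_core_tip`, `stub_core_end`, `stub_h001_good`, ⟨24197⟩ ∕ ⟨24194⟩ OPEN; own crux ⟨22884⟩
`LargeFieldMassRefinementTail` OPEN (blocked-on ⟨19935⟩); the Yang–Mills mass gap is NOT proved; no summit is proved by a line.  THEOREMS ONLY (0 `def`, 0 `sorry`), standard
axioms; the route's local `ℍ` measurability instances.  Width seat ym-line-sfw-p2-w2 g60 (cell ym-idea-1, free hands), `--supports stmt-QuantumFields-24197`.
References: [cite: Luscher1983, §2]; [folklore].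
-/

set_option autoImplicit false
set_option synthInstance.maxSize 1024

noncomputable section

open MeasureTheory Quaternion Set
open scoped Quaternion BigOperators ENNReal
open Literature.MathematicalPhysics.QuantumLattice
open Literature.MathematicalPhysics.QuantumFieldTheory hiding SU2
open Summit.QuantumFields.YangMills.Theorems.SwapTwistDeficit.ToronLog

attribute [local instance] Literature.Analysis.FluidPDE.Tao2016.quatMeasurableSpace
  Literature.Analysis.FluidPDE.Tao2016.quatBorelSpace
  Literature.MathematicalPhysics.QuantumLattice.secondCountableTopology_su2

namespace Summit.QuantumFields.YangMills.Theorems.SwapVirialDeficit.SectorLaplace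

open Summit.QuantumFields.YangMills.Theorems.FemtoTransferGap
open Summit.QuantumFields.YangMills.Theorems.FemtoTransferGap.TT
open Summit.QuantumFields.YangMills.Theorems.VirialFluxGap.RingDeficit
open Summit.QuantumFields.YangMills.Theorems.SwapVirialDeficit.SwapRing
open Summit.QuantumFields.YangMills.Theorems.SwapVirialDeficit.BlowUpRing

variable {L : ℕ} [NeZero L]

set_option maxHeartbeats 800000 in
/-- ★★★ **`stub_core_tip` OF SKELETON ➎ (HOME `fcl-p3-g48-SectorStiffnessSkeleton.lean`, v8 = v9 = v10 statement) VERBATIM, FROM ONE HYPOTHESIS `hT` — THE TIP SLAB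
AGAINST THE BULK'S MORSE–BOTT MAIN TERM in the letters `(δ, η)`**: if for every `L`, every cut `0 < τ ≤ τ₀∕L^k`, every `b ≥ K·L^k·τ⁻¹^k` and every good `ε`
`κ_L·(coneConst·π·∫_{{(1+δ²)⁻¹ < τ}} e^{−bF̂(hubAt δ 1, ε, η)} dμ_B) ≤ (1∕64)·((2π∕b)^α·∫_{HubBulk τ}∫_{ℝ²}𝔪_ε)`, then the TIP core `TipHub τ ×ˢ univ` weighs at most
`1∕32` of the good bulk mass above a merged threshold (✓`setIntegral_tipHub_exp_eq_hubCot`, LEAD's ✓`bulkHub_ge_half_main`). [cite: Luscher1983, §2] -/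
theorem stub_core_tip_of_tipBound
    (hT : ∃ K : ℝ, 0 < K ∧ ∃ k : ℕ, ∃ τ₀ : ℝ, 0 < τ₀ ∧ τ₀ ≤ 1 / 2 ∧ ∀ (L : ℕ) [NeZero L] (τ : ℝ), 0 < τ → τ ≤ τ₀ / (L : ℝ) ^ k →
      ∀ b : ℝ, K * (L : ℝ) ^ k * τ⁻¹ ^ k ≤ b → ∀ ε : GnoSign L, GoodSign ε →
        stiffKappa L (1 / 8) * (coneConst * Real.pi *
          ∫ p in {p : ℝ × GnoCoord L | (1 + p.1 ^ 2)⁻¹ < τ},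
              Real.exp (-(b * gnoDeficit z₀ (fun _ => 1) (hubAt p.1 1) ε p.2))
              ∂((volume : Measure (ℝ × GnoCoord L)).withDensity fun p => ENNReal.ofReal (((1 + p.1 ^ 2)⁻¹) ^ 2 * gnoDensity p.2))) ≤
          (1 / 64 : ℝ) * ((2 * Real.pi / b) ^ alpha L * ∫ a in HubBulk τ, (∫ p : ℝ × ℝ, mbDensity a ε p) ∂coneMeasure)) :
    ∃ K : ℝ, 0 < K ∧ ∃ k : ℕ, ∃ τ₀ : ℝ, 0 < τ₀ ∧ τ₀ ≤ 1 / 2 ∧ ∀ (L : ℕ) [NeZero L] (τ : ℝ), 0 < τ → τ ≤ τ₀ / (L : ℝ) ^ k →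
      ∀ b : ℝ, K * (L : ℝ) ^ k * τ⁻¹ ^ k ≤ b →
        stiffKappa L (1 / 8) * ∑ ε ∈ (Finset.univ.filter fun ε : GnoSign L => GoodSign ε),
            ∫ x in TipHub τ ×ˢ (univ : Set (GnoCoord L)), Real.exp (-(b * gnoDeficit z₀ (fun _ => 1) x.1 ε x.2)) ∂chartMeasure L ≤
          (1 / 32 : ℝ) * ∑ ε ∈ (Finset.univ.filter fun ε : GnoSign L => GoodSign ε), ∫ a in HubBulk τ, hubIntegral a ε b ∂coneMeasure := by
  obtain ⟨K₂, hK₂, k₂, hS2⟩ := bulk_fibred_plane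
  obtain ⟨KT, hKT, kT, τT, hτT, hτTh, hTf⟩ := hT
  -- the absolute constants of the bulk threshold
  set A₀ : ℝ := |Real.log (coneMeasure.real (HubBulk (1 / 2)))| + |Real.log (coneConst ^ 3 / 64)| with hA₀
  set D₀ : ℝ := 40000 * (K₂ + 1) ^ (k₂ + 1) * (A₀ + 183620 + 40) with hD₀
  set dB : ℕ := 20 + k₂ + k₂ * k₂ with hdB
  have hD₀0 : 0 < D₀ := by rw [hD₀, hA₀]; positivity
  have hD4 : 0 < D₀ ^ 4 := pow_pos hD₀0 4
  have hKsum0 : 0 < KT + D₀ ^ 4 := add_pos hKT hD4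
  refine ⟨KT + D₀ ^ 4, hKsum0, kT + 4 * dB, τT, hτT, hτTh, fun L _ τ hτ hτle b hb => ?_⟩
  have hL1 : (1 : ℝ) ≤ L := by exact_mod_cast NeZero.one_le
  have hL0 : (0 : ℝ) < L := by linarith
  set k : ℕ := kT + 4 * dB with hk
  have hLk : (1 : ℝ) ≤ (L : ℝ) ^ k := one_le_pow₀ hL1
  have hτ1 : τ ≤ 1 / 2 := hτle.trans ((div_le_self hτT.le hLk).trans hτTh)
  have hτi1 : 1 ≤ τ⁻¹ := by rw [one_le_inv₀ hτ]; linarith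
  have hτleT : τ ≤ τT / (L : ℝ) ^ kT :=
    hτle.trans (div_le_div₀ hτT.le le_rfl (by positivity) (pow_le_pow_right₀ hL1 (by omega)))
  -- the two thresholds
  have hmono : ∀ {K' : ℝ} {k' : ℕ}, 0 < K' → K' ≤ KT + D₀ ^ 4 → k' ≤ k → K' * (L : ℝ) ^ k' * τ⁻¹ ^ k' ≤ b := by
    intro K' k' hK' hK'le hk'
    have h1 : τ⁻¹ ^ k' ≤ τ⁻¹ ^ k := pow_le_pow_right₀ hτi1 hk'
    have h3 : (L : ℝ) ^ k' ≤ (L : ℝ) ^ k := pow_le_pow_right₀ hL1 hk'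
    calc K' * (L : ℝ) ^ k' * τ⁻¹ ^ k' ≤ (KT + D₀ ^ 4) * (L : ℝ) ^ k * τ⁻¹ ^ k :=
          mul_le_mul (mul_le_mul hK'le h3 (by positivity) hKsum0.le) h1 (by positivity) (mul_nonneg hKsum0.le (by positivity))
      _ ≤ b := hb
  have hbT : KT * (L : ℝ) ^ kT * τ⁻¹ ^ kT ≤ b := hmono hKT (by linarith) (by omega)
  have hbB' : D₀ ^ 4 * (L : ℝ) ^ (4 * dB) * τ⁻¹ ^ (4 * dB) ≤ b := hmono hD4 (by linarith) (by omega)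
  have hbB : (40000 * (K₂ + 1) ^ (k₂ + 1) *
      ((|Real.log (coneMeasure.real (HubBulk (1 / 2)))| + |Real.log (coneConst ^ 3 / 64)| + 183620 * (L : ℝ) ^ 8) + 40) *
        (L : ℝ) ^ (12 + k₂ + k₂ * k₂) * τ⁻¹ ^ k₂) ^ 4 ≤ b := by
    refine le_trans ?_ hbB'
    have h1 : 40000 * (K₂ + 1) ^ (k₂ + 1) *
        ((|Real.log (coneMeasure.real (HubBulk (1 / 2)))| + |Real.log (coneConst ^ 3 / 64)| + 183620 * (L : ℝ) ^ 8) + 40) *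
          (L : ℝ) ^ (12 + k₂ + k₂ * k₂) * τ⁻¹ ^ k₂ ≤ D₀ * (L : ℝ) ^ dB * τ⁻¹ ^ dB := by
      have hL8 : (1 : ℝ) ≤ (L : ℝ) ^ 8 := one_le_pow₀ hL1
      have hin : (|Real.log (coneMeasure.real (HubBulk (1 / 2)))| + |Real.log (coneConst ^ 3 / 64)| + 183620 * (L : ℝ) ^ 8) + 40 ≤
          (A₀ + 183620 + 40) * (L : ℝ) ^ 8 := by
        rw [hA₀]; nlinarith [abs_nonneg (Real.log (coneMeasure.real (HubBulk (1 / 2)))), abs_nonneg (Real.log (coneConst ^ 3 / 64))]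
      calc 40000 * (K₂ + 1) ^ (k₂ + 1) *
            ((|Real.log (coneMeasure.real (HubBulk (1 / 2)))| + |Real.log (coneConst ^ 3 / 64)| + 183620 * (L : ℝ) ^ 8) + 40) *
              (L : ℝ) ^ (12 + k₂ + k₂ * k₂) * τ⁻¹ ^ k₂
          ≤ 40000 * (K₂ + 1) ^ (k₂ + 1) * ((A₀ + 183620 + 40) * (L : ℝ) ^ 8) * (L : ℝ) ^ (12 + k₂ + k₂ * k₂) * τ⁻¹ ^ dB := by
            refine mul_le_mul (mul_le_mul_of_nonneg_right (mul_le_mul_of_nonneg_left hin (by positivity)) (by positivity))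
              (pow_le_pow_right₀ hτi1 (by omega)) (by positivity) (by positivity)
        _ = D₀ * (L : ℝ) ^ dB * τ⁻¹ ^ dB := by rw [hD₀, hdB]; ring
    have h0 : 0 ≤ 40000 * (K₂ + 1) ^ (k₂ + 1) *
        ((|Real.log (coneMeasure.real (HubBulk (1 / 2)))| + |Real.log (coneConst ^ 3 / 64)| + 183620 * (L : ℝ) ^ 8) + 40) *
          (L : ℝ) ^ (12 + k₂ + k₂ * k₂) * τ⁻¹ ^ k₂ := by positivity
    calc _ ≤ (D₀ * (L : ℝ) ^ dB * τ⁻¹ ^ dB) ^ 4 := pow_le_pow_left₀ h0 h1 4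
      _ = D₀ ^ 4 * (L : ℝ) ^ (4 * dB) * τ⁻¹ ^ (4 * dB) := by rw [mul_pow, mul_pow, ← pow_mul, ← pow_mul, mul_comm dB 4]
  have hb0 : 0 ≤ b := le_trans (by positivity) hbT
  have hκ : 0 ≤ stiffKappa L (1 / 8) := (stiffKappa_pos_le_exp (L := L)).1.le
  -- per sign pattern
  have hper : ∀ ε ∈ (Finset.univ.filter fun ε : GnoSign L => GoodSign ε),
      stiffKappa L (1 / 8) * ∫ x in TipHub τ ×ˢ (univ : Set (GnoCoord L)), Real.exp (-(b * gnoDeficit z₀ (fun _ => 1) x.1 ε x.2)) ∂chartMeasure L ≤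
        (1 / 32 : ℝ) * ∫ a in HubBulk τ, hubIntegral a ε b ∂coneMeasure := by
    intro ε hεm
    have hε : GoodSign ε := (Finset.mem_filter.1 hεm).2
    have hread := setIntegral_tipHub_exp_eq_hubCot z₀ (fun _ => (1 : SU2)) ε τ b
    have hTε := hTf L τ hτ hτleT b hbT ε hε
    have hZ := bulkHub_ge_half_main hK₂ (hS2 L) hε hτ hτ1 hbB
    rw [hread]
    linarith
  calc stiffKappa L (1 / 8) * ∑ ε ∈ (Finset.univ.filter fun ε : GnoSign L => GoodSign ε),
        ∫ x in TipHub τ ×ˢ (univ : Set (GnoCoord L)), Real.exp (-(b * gnoDeficit z₀ (fun _ => 1) x.1 ε x.2)) ∂chartMeasure L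
      = ∑ ε ∈ (Finset.univ.filter fun ε : GnoSign L => GoodSign ε), stiffKappa L (1 / 8) *
          ∫ x in TipHub τ ×ˢ (univ : Set (GnoCoord L)), Real.exp (-(b * gnoDeficit z₀ (fun _ => 1) x.1 ε x.2)) ∂chartMeasure L := Finset.mul_sum _ _ _
    _ ≤ ∑ ε ∈ (Finset.univ.filter fun ε : GnoSign L => GoodSign ε), (1 / 32 : ℝ) * ∫ a in HubBulk τ, hubIntegral a ε b ∂coneMeasure := Finset.sum_le_sum hper
    _ = _ := (Finset.mul_sum _ _ _).symm

/-- ★★ **`stub_core_tip` FROM A DIRECT SHELL COMPARISON** (the second entry point, w2 g60 memo2: no Morse–Bott currency at all): if for every `L`, every cut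
`0 < τ ≤ τ₀∕L^k`, every `b ≥ K·L^k·τ⁻¹^k` and every good `ε` the tip window weighs at most `1∕32` of the bulk hub integral DIRECTLY,
`κ_L·(coneConst·π·∫_{{(1+δ²)⁻¹ < τ}} e^{−bF̂(hubAt δ 1, ε, η)} dμ_B) ≤ (1∕32)·∫_{HubBulk τ} hubIntegral a ε b dcone` (e.g. through the adjacent shell
`{τ ≤ sin²ψ ≤ sin²r} ⊆ HubBulk τ` and a two-sided fibred Laplace step ACROSS the apex in Cartesian hub letters), then `stub_core_tip` of ➎ holds VERBATIM
(✓`setIntegral_tipHub_exp_eq_hubCot` and the sign sum; no threshold merging needed). [folklore] -/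
theorem stub_core_tip_of_shellBound
    (hT : ∃ K : ℝ, 0 < K ∧ ∃ k : ℕ, ∃ τ₀ : ℝ, 0 < τ₀ ∧ τ₀ ≤ 1 / 2 ∧ ∀ (L : ℕ) [NeZero L] (τ : ℝ), 0 < τ → τ ≤ τ₀ / (L : ℝ) ^ k →
      ∀ b : ℝ, K * (L : ℝ) ^ k * τ⁻¹ ^ k ≤ b → ∀ ε : GnoSign L, GoodSign ε →
        stiffKappa L (1 / 8) * (coneConst * Real.pi *
          ∫ p in {p : ℝ × GnoCoord L | (1 + p.1 ^ 2)⁻¹ < τ},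
              Real.exp (-(b * gnoDeficit z₀ (fun _ => 1) (hubAt p.1 1) ε p.2))
              ∂((volume : Measure (ℝ × GnoCoord L)).withDensity fun p => ENNReal.ofReal (((1 + p.1 ^ 2)⁻¹) ^ 2 * gnoDensity p.2))) ≤
          (1 / 32 : ℝ) * ∫ a in HubBulk τ, hubIntegral a ε b ∂coneMeasure) :
    ∃ K : ℝ, 0 < K ∧ ∃ k : ℕ, ∃ τ₀ : ℝ, 0 < τ₀ ∧ τ₀ ≤ 1 / 2 ∧ ∀ (L : ℕ) [NeZero L] (τ : ℝ), 0 < τ → τ ≤ τ₀ / (L : ℝ) ^ k →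
      ∀ b : ℝ, K * (L : ℝ) ^ k * τ⁻¹ ^ k ≤ b →
        stiffKappa L (1 / 8) * ∑ ε ∈ (Finset.univ.filter fun ε : GnoSign L => GoodSign ε),
            ∫ x in TipHub τ ×ˢ (univ : Set (GnoCoord L)), Real.exp (-(b * gnoDeficit z₀ (fun _ => 1) x.1 ε x.2)) ∂chartMeasure L ≤
          (1 / 32 : ℝ) * ∑ ε ∈ (Finset.univ.filter fun ε : GnoSign L => GoodSign ε), ∫ a in HubBulk τ, hubIntegral a ε b ∂coneMeasure := by
  obtain ⟨KT, hKT, kT, τT, hτT, hτTh, hTf⟩ := hT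
  refine ⟨KT, hKT, kT, τT, hτT, hτTh, fun L _ τ hτ hτle b hb => ?_⟩
  have hper : ∀ ε ∈ (Finset.univ.filter fun ε : GnoSign L => GoodSign ε),
      stiffKappa L (1 / 8) * ∫ x in TipHub τ ×ˢ (univ : Set (GnoCoord L)), Real.exp (-(b * gnoDeficit z₀ (fun _ => 1) x.1 ε x.2)) ∂chartMeasure L ≤
        (1 / 32 : ℝ) * ∫ a in HubBulk τ, hubIntegral a ε b ∂coneMeasure := by
    intro ε hεm
    have hε : GoodSign ε := (Finset.mem_filter.1 hεm).2
    rw [setIntegral_tipHub_exp_eq_hubCot z₀ (fun _ => (1 : SU2)) ε τ b]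
    exact hTf L τ hτ hτle b hb ε hε
  calc stiffKappa L (1 / 8) * ∑ ε ∈ (Finset.univ.filter fun ε : GnoSign L => GoodSign ε),
        ∫ x in TipHub τ ×ˢ (univ : Set (GnoCoord L)), Real.exp (-(b * gnoDeficit z₀ (fun _ => 1) x.1 ε x.2)) ∂chartMeasure L
      = ∑ ε ∈ (Finset.univ.filter fun ε : GnoSign L => GoodSign ε), stiffKappa L (1 / 8) *
          ∫ x in TipHub τ ×ˢ (univ : Set (GnoCoord L)), Real.exp (-(b * gnoDeficit z₀ (fun _ => 1) x.1 ε x.2)) ∂chartMeasure L := Finset.mul_sum _ _ _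
    _ ≤ ∑ ε ∈ (Finset.univ.filter fun ε : GnoSign L => GoodSign ε), (1 / 32 : ℝ) * ∫ a in HubBulk τ, hubIntegral a ε b ∂coneMeasure := Finset.sum_le_sum hper
    _ = _ := (Finset.mul_sum _ _ _).symm

/-- ★ **THE ADJACENT SHELL IS PART OF THE BULK**: for `0 ≤ b`, any hub set `S ⊆ HubBulk τ` (e.g. the shell `{τ ≤ sin²ψ ≤ sin²r, τ ≤ sin²2ψ}`),
`∫_S hubIntegral ≤ ∫_{HubBulk τ} hubIntegral` (the hub integral is `≥ 0`). So a tip bound against the shell is a tip bound against the bulk. [folklore] -/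
theorem setIntegral_hubIntegral_mono {S : Set ℍ} {τ : ℝ} (hSτ : S ⊆ HubBulk τ) (ε : GnoSign L) {b : ℝ} (hb : 0 ≤ b) :
    ∫ a in S, hubIntegral a ε b ∂coneMeasure ≤ ∫ a in HubBulk τ, hubIntegral (L := L) a ε b ∂coneMeasure := by
  have hint : Integrable (fun a : ℍ => hubIntegral (L := L) a ε b) coneMeasure := integrable_hubIntegral hb ε
  exact setIntegral_mono_set hint.integrableOn (Filter.Eventually.of_forall fun a => hubIntegral_nonneg a ε b) (Filter.Eventually.of_forall hSτ)

end Summit.QuantumFields.YangMills.Theorems.SwapVirialDeficit.SectorLaplace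

end
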